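import Summits.AtomisticToContinuum.HydrodynamicLimit.Theses.MirrorJeffreys
import HarnessLib

/-!
# Line `birth` — BIRTH SKELETON of crux `MirrorJeffreys.ForwardMeanHydro` (stmt-AtomisticToContinuum-17767)

Route `route-AtomisticToContinuum-MirrorJeffreys` (sub-problem `HydrodynamicLimit`), crux #2 (rank 2):
`Summit.AtomisticToContinuum.HydrodynamicLimit.Theses.MirrorJeffreys.ForwardMeanHydro` — HYDRODYNAMICS IN THE MEAN,
FORWARD, IN THE DILUTE BAND: under the conjunct's hypotheses (continuous local Gibbs profiles, `σ < σ₀`, a classical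
hs-Euler solution `P = (ρ, u, θ)` on `[0, T)` whose packing `ρσ³` stays below a prover-chosen `η₀`, flows `Φ_N`, local
Gibbs laws `f₀` that are probability measures whose fields converge at `t = 0`) the EXPECTED tilt statistics
`E_{f₀}⟨ζ, F(Φ_N(t) z)⟩` converge, for every `t ∈ [0, T)` and every continuous tilt `ζ = (ζ_ρ, ζ_m, ζ_e)`, to
`⟨ζ, P_t⟩ = ∫ (ζ_ρ ρ_t + ρ_t⟨ζ_m, u_t⟩ + ζ_e E_t) dx`.

## The cut — the route's recorded two-layer plan G2 ("MeanFluxClosure → MeanGronwall"), typed FLUX-EXACTLY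

The tilt statistic is a ONE-BODY additive functional, so its mean obeys an EXACT finite-`N` balance law (Bogolyubov's
weak equation in the mean: free transport between collisions + jumps at collisions), and the classical solution obeys
the EXACT weak Euler identity. Subtracting, mean hydrodynamics at time `t` for a SMOOTH time-independent tilt is
EQUIVALENT to: (mean convergence at `t = 0`) + (the time-integrated mean microscopic fluxes converge to the
time-integrated Euler fluxes of `P`). No Grönwall and no stability constant appear: for time-independent tilts the
duality is exact, so "MeanGronwall" of G2 collapses into the two exact identities, and ALL the open content sits in the
two named closure limits — split by MECHANISM into the one-body (streaming / local-Maxwellian) part and the two-body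
(collisional-transfer / contact-value) part, whose limits are respectively the ideal-gas Euler fluxes and the
excess-pressure fluxes `p_hs − ρθ = ρθ(Z(ρσ³) − 1)` of the SAME classical solution:

* `stub_kineticFluxClosure` (OPEN, XL — HARDEST): `E_{f₀}[∫₀ᵗ streamingRate ζ (Φ_s z) ds] → ∫₀ᵗ∫ (ρu·∇ζ_ρ +
  (ρu⊗u + ρθ𝟙):∇ζ_m + (E + ρθ)u·∇ζ_e)` — the velocity moments of orders 1–3 of the ONE-PARTICLE MARGINAL, paired with
  smooth gradients and integrated in time, take their local-Maxwellian values along `P` (local equilibrium IN THE MEAN;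
  zero mean heat flux, isotropic mean kinetic stress).
* `stub_collisionalTransferClosure` (OPEN, XL): `E_{f₀}[collisionalTransfer] → ∫₀ᵗ∫ (p_hs − ρθ)(div ζ_m + u·∇ζ_e)` — the
  mean momentum/energy transferred AT CONTACT (a two-body, contact-shell statistic, `O(1)` at fixed reduced density
  `σ`: `(N+1)^{4/3}σ²` collisions per unit time × impulse arm `σ(N+1)^{-1/3}`, normalised by `N+1`) takes the virial
  value: contact pair correlation ↔ `Z − 1 = η f_ex′(η)` (`hsCompressibility`), isotropic, convected with `u`.
* `stub_meanBalanceLaw` (exact finite-`N` identity, M–L): `E[⟨ζ,F(Φ_t z)⟩] − E[⟨ζ,F(Φ_0 z)⟩] = E[∫₀ᵗ streamingRate] +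
  E[collisionalTransfer]` for `0 < σ < 1/2`, smooth tilts, `t ≥ 0` — Bogolyubov 1975 / Pulvirenti–Simonella
  arXiv:1504.03215 §1 in the mean; the un-mollified twin of the LANDED pathwise identity
  `Theorems.ChaosClosesEulerWeakEquation.stub_weakEquation` (p108039: `glue_pieces`, `ftc_free_left`,
  `pairSum_eq_particleSum`), plus `f₀`-integrability of the streaming term (Gaussian velocity moments of the local Gibbs
  law, `QuenchedCellClock.integrable_sum_norm_sq_localGibbsLaw`-type bounds; joint measurability of `(s,z) ↦ Φ_s z` from
  right-continuity of good orbits).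
* `stub_eulerWeakForm` (exact macroscopic identity, M): for a classical hs-Euler solution whose packing stays below an
  EOS-regularity threshold `η₁` (prover-chosen, `∃ η₁` outermost; `HsEosLowDensity` landed as
  `Theorems.ImplosionDichotomyHsEosLowDensity` makes `η ↦ Z(η)` smooth on `[0, η₁)`, so the pressure field is smooth and
  the structure's `Torus.gradient`/`divergence` are true derivatives): `⟨ζ,P_t⟩ − ⟨ζ,P_0⟩ = kineticFluxIntegral +
  excessFluxIntegral` — multiply the three equations of `IsHardSphereEulerSolution` by `ζ`, integrate by parts on `𝕋³`
  (`Torus.integral_inner_gradient_eq_neg_integral_mul_divergence` & co., proved in `TorusCalculusProofs`), integrate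
  `timeDerivWithin` over `[0, t] ⊂ [0, T)`.
* `stub_initialMeanConvergence` (M): at `t = 0`, convergence IN PROBABILITY of the three fields (`TendstoHydroFieldsAt …
  0`, the crux's hypothesis) upgrades to convergence IN MEAN of every continuous tilt statistic, by uniform integrability
  (`N`-uniform second moments of `(N+1)⁻¹Σ(1 + |vᵢ|²)` under local Gibbs laws: Gaussian velocities given positions) and
  `tiltStatistic_eq_fields`; continuity of `(ρ₀, u₀, θ₀)` splits the target integral.
* `stub_continuousTiltExtension` (M): at fixed `t`, mean convergence for all SMOOTH tilts extends to all CONTINUOUS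
  tilts: `|E⟨ζ − ζ′, F(Φ_t z)⟩| ≤ ‖ζ − ζ′‖_∞ E[(N+1)⁻¹Σ(1 + |vᵢ(t)| + |vᵢ(t)|²/2)] ≤ C‖ζ − ζ′‖_∞` uniformly in `N`
  (kinetic energy conserved on good orbits, `HardSphereFlow.configEnergy_flow`; `f₀ ≪` Liouville), smooth functions are
  dense in `C(𝕋³)` (Fourier / Stone–Weierstrass on `UnitAddTorus`), `ε/3`.

ASSEMBLY `ForwardMeanHydro_of` (PROVED, no `sorry`; hypotheses = the six stub statements BY STUB NAME via the
`__Registered.stub_*` aliases of §2, device of `Cruxes/ChaosClosure/Lines/birth.lean`): `η₀ := min η_K (min η_C η₁)`, `σ₀ := min σ_K (min σ_C ½)`; continuity of the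
Euler slices at `0` and `t` from `IsSmoothSpaceTimeOn.isSmooth_slice`; reduce to smooth tilts by
`stub_continuousTiltExtension`; for a smooth tilt: balance law (per `N`) + the three limits (initial, kinetic,
collisional: `Tendsto.add`) + the weak Euler identity (`linarith` inside `Tendsto.congr`). The closing `example`
wires the six sorried stubs in (certifies the registered signatures ARE the hypotheses).

WHY THIS CUT (rejected alternatives). (i) `HydrodynamicLimit → ForwardMeanHydro` + UI (the route's own support
HydroLimitForcesForward) would make a stub the SUMMIT (costume). (ii) "short-time mean hydro + restart" needs a restart
from a non-Gibbs law (Yau's obstruction) — the second stub would be the crux reworded. (iii) G2 literal (mean MOLLIFIED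
fields as approximate weak solutions + weak-topology stability of classical Euler) is FALSE without an entropy
admissibility the mean cannot carry (wild / measure-valued solutions, De Lellis–Székelyhidi; Brenier–De Lellis–Székelyhidi
2011), and typing nonlinear fluxes of mean fields needs pointwise densities. (iv) A linearised-adjoint transport version
(backward linearised hs-Euler, `Literature.Analysis.FluidPDE.LinearizedHsEuler`) needs the explicit flux Jacobian and mixes
closure with quadratic proximity. The present cut uses only EXACT identities + two closure limits, each linear in the
law, each a statement every mean-level engine (BBGKY/Enskog duality, kinetic windows, empirical Enskog chaos) must
deliver anyway — which is the route's thesis (ii).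

HONESTY. The two closure stubs together are STRONGER than the crux (they identify the kinetic and the collisional parts
separately; the crux only needs their sum) — deliberately: they are the two physically distinct local-equilibrium
statements (one-body Maxwellian moments / two-body contact value), cf. the in-probability cellwise analogues
`ChaosClosure.Birth.WeakStressIsotropyInBand` / `CollisionalPressureValueInBand` of the neighbouring skeleton. Free flight
(`σ = 0`) fails `stub_kineticFluxClosure` (phase mixing keeps the kinetic stress anisotropic) exactly as it fails the
crux; every item carries the `t = 0` tie `TendstoHydroFieldsAt … 0`, the probability guard and the packing guard
verbatim (negatives 9168, 9236/9238, 6610/6612 untouched; no radii / cells / `r`-before-`N` quantifiers anywhere), and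
every conclusion lives under `∀ t ∈ Set.Ico 0 T` or carries explicit continuity hypotheses on the `t = 0` slices
(the `T ≤ 0` / Vitali corner of negative 9395 cannot arise).

DISPROOF USED: none relevant — `Cruxes/ForwardMeanHydro/` had no `Disproof.lean`, no `Negative/` lemma and no prior line
at registration (`ledger crux ls stmt-AtomisticToContinuum-17767`: no workfiles, 2026-08-17); dead lines: none recorded.

BC3 AUDIT (planner-skel-stmt-AtomisticToContinuum-17767-0, 2026-08-17): see `Lines/birth.md` — `lean check --json` rc 0,
sorries = 6 = the six `stub_*` and nothing else; probes `stub → ForwardMeanHydro` and `stub → _root_.HydrodynamicLimit`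
by `first | exact? | simpa | aesop` FAIL for all six stubs (12/12).
-/

noncomputable section

namespace Summit.AtomisticToContinuum.HydrodynamicLimit.Cruxes.ForwardMeanHydro.Birth

open scoped BigOperators Topology Classical MeasureTheory ENNReal InnerProductSpace
open Filter Set MeasureTheory
open Literature.MathematicalPhysics.KineticTheory
open Literature.Analysis.FluidPDE
open Literature.Analysis.FunctionSpaces
open Summit.AtomisticToContinuum.HydrodynamicLimit.Theses.MirrorJeffreys (ForwardMeanHydro)

/-! ## §1 Typed functionals (the microscopic fluxes in the mean; the macroscopic flux pairings) -/

/-- **Mean tilt statistic at time `t`.** `E_{f₀}[⟨ζ, F(Φ_t z)⟩]`: the crux's INLINE tilt statistic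
`∫ (ζ_ρ(x) + ⟪ζ_m(x), v⟫ + ζ_e(x)|v|²/2) dμ_{Φ_t z}(x, v)` (verbatim the integrand of `ForwardMeanHydro`; equal to
`KineticTheory.tiltStatistic ζ_ρ ζ_e ζ_m (Φ_t z)` by `rfl`) integrated against the local Gibbs law
`f₀ = localGibbsLaw σ a₀ u₀ θ₀ N Φ`. [folklore] -/
def meanTilt (σ : ℝ) (a₀ : T3 → ℝ) (u₀ : T3 → V3) (θ₀ : T3 → ℝ) (N : ℕ)
    (Φ : HardSphereFlow (Torus.geometry (Fin 3)) (hsDiameter σ N) (N + 1)) (t : ℝ)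
    (ζρ ζe : T3 → ℝ) (ζm : T3 → V3) : ℝ :=
  ∫ z, (∫ y, (ζρ y.1 + ⟪ζm y.1, y.2⟫_ℝ + ζe y.1 * (‖y.2‖ ^ 2 / 2)) ∂(empiricalMeasure (Φ.flow t z)))
    ∂(localGibbsLaw σ a₀ u₀ θ₀ N Φ)

/-- **Streaming (free-transport) rate of the tilt statistic** at a configuration `w`, for a time-independent
smooth tilt: `∫ (⟪v, ∇ζ_ρ(x)⟫ + Σ_{jk} v_j v_k ∂_j ζ_{m,k}(x) + (|v|²/2) ⟪v, ∇ζ_e(x)⟫) dμ_w(x, v)` — the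
`d/ds` of `⟨ζ, F(w(s))⟩` along free flight (`ẋ = v`, `v̇ = 0`). [folklore] -/
def streamingRate (ζρ ζe : T3 → ℝ) (ζm : T3 → V3) {N : ℕ} (w : Config N (Fin 3) T3) : ℝ :=
  ∫ y, (⟪y.2, Torus.gradient ζρ y.1⟫_ℝ
        + (∑ j : Fin 3, ∑ k : Fin 3, y.2 j * y.2 k * Torus.partialDeriv j (fun x => ζm x k) y.1)
        + ‖y.2‖ ^ 2 / 2 * ⟪y.2, Torus.gradient ζe y.1⟫_ℝ) ∂(empiricalMeasure w)

/-- **Mean time-integrated streaming (kinetic) flux** over `[0, t]`: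
`E_{f₀}[ ∫_{[0,t]} streamingRate ζ (Φ_s z) ds ]` (pathwise time integral inside, expectation outside). [folklore] -/
def meanStreamingFlux (σ : ℝ) (a₀ : T3 → ℝ) (u₀ : T3 → V3) (θ₀ : T3 → ℝ) (N : ℕ)
    (Φ : HardSphereFlow (Torus.geometry (Fin 3)) (hsDiameter σ N) (N + 1)) (t : ℝ)
    (ζρ ζe : T3 → ℝ) (ζm : T3 → V3) : ℝ :=
  ∫ z, (∫ s in Set.Icc 0 t, streamingRate ζρ ζe ζm (Φ.flow s z)) ∂(localGibbsLaw σ a₀ u₀ θ₀ N Φ)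

/-- **Collisional transfer functional** of the orbit of `z` over the collision times in `(0, t]`: `(N+1)⁻¹ Σ_{s}
Σ_{ordered contact pairs (i,j)} [⟪ζ_m(x_i(s)), v_i(s) − v_i⁻⟫ + ζ_e(x_i(s)) (|v_i(s)|² − |v_i⁻|²)/2]`, the jumps of the
one-body statistic at collisions (`v_i⁻ = (reflectVel n (v_i, v_j)).1` the pre-collisional velocity; `ζ_ρ` does not
jump). Typed VERBATIM in the format of the landed Bogolyubov identity
`Theorems.ChaosClosesEulerWeakEquation.stub_weakEquation` (same `collisionTimes`/`sepVec`/`reflectVel` enumeration). [folklore] -/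
def collisionalTransfer (σ : ℝ) {N : ℕ}
    (Φ : HardSphereFlow (Torus.geometry (Fin 3)) (hsDiameter σ N) (N + 1)) (t : ℝ)
    (ζe : T3 → ℝ) (ζm : T3 → V3) (z : Config (N + 1) (Fin 3) T3) : ℝ :=
  let ε := hsDiameter σ N
  let G : Geometry (Fin 3) T3 := Torus.geometry (Fin 3)
  let γ : ℝ → Config (N + 1) (Fin 3) T3 := fun s => Φ.flow s z
  let pv : ℝ → Fin (N + 1) → Fin (N + 1) → V3 × V3 := fun s i j =>
    reflectVel (G.sepVec (γ s i).1 (γ s j).1) ((γ s i).2, (γ s j).2)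
  (N + 1 : ℝ)⁻¹ * ∑ᶠ (s : ℝ) (_ : s ∈ collisionTimes G ε γ ∩ Set.Ioc 0 t),
    ∑ i : Fin (N + 1), ∑ j : Fin (N + 1),
      (if i ≠ j ∧ ‖G.sepVec (γ s i).1 (γ s j).1‖ = ε then
        (⟪ζm (γ s i).1, (γ s i).2 - (pv s i j).1⟫_ℝ
          + ζe (γ s i).1 * ((‖(γ s i).2‖ ^ 2 - ‖(pv s i j).1‖ ^ 2) / 2)) else 0)

/-- **Mean collisional transfer** over `(0, t]`: `E_{f₀}[collisionalTransfer]`. [folklore] -/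
def meanCollisionalTransfer (σ : ℝ) (a₀ : T3 → ℝ) (u₀ : T3 → V3) (θ₀ : T3 → ℝ) (N : ℕ)
    (Φ : HardSphereFlow (Torus.geometry (Fin 3)) (hsDiameter σ N) (N + 1)) (t : ℝ)
    (ζe : T3 → ℝ) (ζm : T3 → V3) : ℝ :=
  ∫ z, collisionalTransfer σ Φ t ζe ζm z ∂(localGibbsLaw σ a₀ u₀ θ₀ N Φ)

/-- **Macroscopic pairing** `⟨ζ, (R, RU, E(R,U,Θ))⟩ = ∫ (ζ_ρ R + R⟪ζ_m, U⟫ + ζ_e E) dx` — verbatim the limit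
expression of `ForwardMeanHydro` at the fields `(R, U, Θ) = (ρ_t, u_t, θ_t)`. [folklore] -/
def macroPairing (R : T3 → ℝ) (U : T3 → V3) (Θ : T3 → ℝ) (ζρ ζe : T3 → ℝ) (ζm : T3 → V3) : ℝ :=
  ∫ x, (ζρ x * R x + R x * ⟪ζm x, U x⟫_ℝ + ζe x * totalEnergyDensity (R x) (U x) (Θ x))

/-- **Kinetic (ideal-gas) part of the time-integrated Euler flux pairing** along `(ρ, u, θ)`:
`∫_{[0,t]} ∫ (ρ⟪u, ∇ζ_ρ⟫ + ρ Σ_{jk} u_j u_k ∂_jζ_{m,k} + ρθ div ζ_m + (E + ρθ)⟪u, ∇ζ_e⟫) dx ds` — the local-Maxwellian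
values of the streaming rate (`∫M v⊗v = ρu⊗u + ρθ𝟙`, `∫M |v|²v/2 = (E + ρθ)u`, zero heat flux). [folklore] -/
def kineticFluxIntegral (ρ : ℝ → T3 → ℝ) (u : ℝ → T3 → V3) (θ : ℝ → T3 → ℝ) (t : ℝ)
    (ζρ ζe : T3 → ℝ) (ζm : T3 → V3) : ℝ :=
  ∫ s in Set.Icc 0 t, ∫ x,
    (ρ s x * ⟪u s x, Torus.gradient ζρ x⟫_ℝ
      + ρ s x * (∑ j : Fin 3, ∑ k : Fin 3, u s x j * u s x k * Torus.partialDeriv j (fun y => ζm y k) x)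
      + ρ s x * θ s x * Torus.divergence ζm x
      + (totalEnergyDensity (ρ s x) (u s x) (θ s x) + ρ s x * θ s x) * ⟪u s x, Torus.gradient ζe x⟫_ℝ)

/-- **Excess (collisional-transfer) part of the time-integrated Euler flux pairing**:
`∫_{[0,t]} ∫ (p_hs − ρθ)(div ζ_m + ⟪u, ∇ζ_e⟫) dx ds`, `p_hs = hsPressure σ ρ θ = ρθ Z(ρσ³)`, so
`p_hs − ρθ = ρθ(Z − 1)` is the virial / contact-value excess pressure. Kinetic + excess = the full hs-Euler flux
pairing `∫∫ (ρu·∇ζ_ρ + (ρu⊗u + p𝟙):∇ζ_m + (E + p)u·∇ζ_e)`. [folklore] -/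
def excessFluxIntegral (σ : ℝ) (ρ : ℝ → T3 → ℝ) (u : ℝ → T3 → V3) (θ : ℝ → T3 → ℝ) (t : ℝ)
    (ζe : T3 → ℝ) (ζm : T3 → V3) : ℝ :=
  ∫ s in Set.Icc 0 t, ∫ x,
    (hsPressure σ (ρ s x) (θ s x) - ρ s x * θ s x) * (Torus.divergence ζm x + ⟪u s x, Torus.gradient ζe x⟫_ℝ)

/-! ## §2 The stub statements BY STUB NAME — the hypotheses of `ForwardMeanHydro_of`

The native skeleton audit (`#h21_check_skeleton`, run by `ledger skeleton check`) admits a `Prop` hypothesis of the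
composing theorem only if its HEAD CONSTANT is a registered obligation or is named like a declared stub, and the
`@[stub]` tag is gate-reserved; so each stub statement is carried by the alias `abbrev __Registered.stub_X : Prop := …`
(body VERBATIM the sorried theorem `stub_X` of §3) and `ForwardMeanHydro_of` is stated over the six aliases — the device
of `Cruxes/ChaosClosure/Lines/birth.lean` / `Cruxes/FastCollisionThroughput/Lines/birth.lean`. The `__` namespace is an
implementation detail (`Name.isImplementationDetail`), so the audit's stub report resolves each `stub_…` to the sorried
theorem, not to its alias; the `example`s after §3 certify alias = theorem statement definitionally. -/

namespace __Registered

/-- The statement of `stub_kineticFluxClosure` (own, open-problem (XL) — HARDEST), keyed by the registered stub name (hypothesis of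
`ForwardMeanHydro_of`; body VERBATIM the stub's). -/
abbrev stub_kineticFluxClosure : Prop :=
  ∃ η₀ : ℝ, 0 < η₀ ∧ ∀ (a₀ θ₀ : T3 → ℝ) (u₀ : T3 → V3), Continuous a₀ → Continuous θ₀ → Continuous u₀ →
    (∀ x, 0 < a₀ x) → (∀ x, 0 < θ₀ x) → ∃ σ₀ : ℝ, 0 < σ₀ ∧ ∀ σ : ℝ, 0 < σ → σ < σ₀ →
    ∀ (T : ℝ) (ρ θ : ℝ → T3 → ℝ) (u : ℝ → T3 → V3), IsHardSphereEulerSolution σ T ρ u θ →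
    (∀ t ∈ Set.Ico 0 T, ∀ x, ρ t x * σ ^ 3 < η₀) →
    ∀ Φ : (N : ℕ) → HardSphereFlow (Torus.geometry (Fin 3)) (hsDiameter σ N) (N + 1),
    (∀ N, IsProbabilityMeasure (localGibbsLaw σ a₀ u₀ θ₀ N (Φ N))) →
    TendstoHydroFieldsAt (fun N => localGibbsLaw σ a₀ u₀ θ₀ N (Φ N)) Φ ρ u θ 0 →
    ∀ t ∈ Set.Ico 0 T, ∀ (ζρ ζe : T3 → ℝ) (ζm : T3 → V3),
    Torus.IsSmooth ζρ → Torus.IsSmooth ζe → Torus.IsSmooth ζm →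
    Tendsto (fun N : ℕ => meanStreamingFlux σ a₀ u₀ θ₀ N (Φ N) t ζρ ζe ζm) atTop
      (𝓝 (kineticFluxIntegral ρ u θ t ζρ ζe ζm))

/-- The statement of `stub_collisionalTransferClosure` (own, open-problem (XL)), keyed by the registered stub name (hypothesis of
`ForwardMeanHydro_of`; body VERBATIM the stub's). -/
abbrev stub_collisionalTransferClosure : Prop :=
  ∃ η₀ : ℝ, 0 < η₀ ∧ ∀ (a₀ θ₀ : T3 → ℝ) (u₀ : T3 → V3), Continuous a₀ → Continuous θ₀ → Continuous u₀ →
    (∀ x, 0 < a₀ x) → (∀ x, 0 < θ₀ x) → ∃ σ₀ : ℝ, 0 < σ₀ ∧ ∀ σ : ℝ, 0 < σ → σ < σ₀ →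
    ∀ (T : ℝ) (ρ θ : ℝ → T3 → ℝ) (u : ℝ → T3 → V3), IsHardSphereEulerSolution σ T ρ u θ →
    (∀ t ∈ Set.Ico 0 T, ∀ x, ρ t x * σ ^ 3 < η₀) →
    ∀ Φ : (N : ℕ) → HardSphereFlow (Torus.geometry (Fin 3)) (hsDiameter σ N) (N + 1),
    (∀ N, IsProbabilityMeasure (localGibbsLaw σ a₀ u₀ θ₀ N (Φ N))) →
    TendstoHydroFieldsAt (fun N => localGibbsLaw σ a₀ u₀ θ₀ N (Φ N)) Φ ρ u θ 0 →
    ∀ t ∈ Set.Ico 0 T, ∀ (ζρ ζe : T3 → ℝ) (ζm : T3 → V3),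
    Torus.IsSmooth ζρ → Torus.IsSmooth ζe → Torus.IsSmooth ζm →
    Tendsto (fun N : ℕ => meanCollisionalTransfer σ a₀ u₀ θ₀ N (Φ N) t ζe ζm) atTop
      (𝓝 (excessFluxIntegral σ ρ u θ t ζe ζm))

/-- The statement of `stub_meanBalanceLaw` (exact finite-N identity, M–L, provable now), keyed by the registered stub name (hypothesis of
`ForwardMeanHydro_of`; body VERBATIM the stub's). -/
abbrev stub_meanBalanceLaw : Prop :=
  ∀ σ : ℝ, 0 < σ → σ < 1 / 2 → ∀ (a₀ θ₀ : T3 → ℝ) (u₀ : T3 → V3), Continuous a₀ → Continuous θ₀ → Continuous u₀ →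
    (∀ x, 0 < a₀ x) → (∀ x, 0 < θ₀ x) →
    ∀ (N : ℕ) (Φ : HardSphereFlow (Torus.geometry (Fin 3)) (hsDiameter σ N) (N + 1)),
    ∀ t : ℝ, 0 ≤ t → ∀ (ζρ ζe : T3 → ℝ) (ζm : T3 → V3),
    Torus.IsSmooth ζρ → Torus.IsSmooth ζe → Torus.IsSmooth ζm →
    meanTilt σ a₀ u₀ θ₀ N Φ t ζρ ζe ζm - meanTilt σ a₀ u₀ θ₀ N Φ 0 ζρ ζe ζm =
      meanStreamingFlux σ a₀ u₀ θ₀ N Φ t ζρ ζe ζm + meanCollisionalTransfer σ a₀ u₀ θ₀ N Φ t ζe ζm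

/-- The statement of `stub_eulerWeakForm` (exact macroscopic identity, M, provable now), keyed by the registered stub name (hypothesis of
`ForwardMeanHydro_of`; body VERBATIM the stub's). -/
abbrev stub_eulerWeakForm : Prop :=
  ∃ η₁ : ℝ, 0 < η₁ ∧ ∀ σ : ℝ, 0 < σ →
    ∀ (T : ℝ) (ρ θ : ℝ → T3 → ℝ) (u : ℝ → T3 → V3), IsHardSphereEulerSolution σ T ρ u θ →
    (∀ t ∈ Set.Ico 0 T, ∀ x, ρ t x * σ ^ 3 < η₁) →
    ∀ t ∈ Set.Ico 0 T, ∀ (ζρ ζe : T3 → ℝ) (ζm : T3 → V3),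
    Torus.IsSmooth ζρ → Torus.IsSmooth ζe → Torus.IsSmooth ζm →
    macroPairing (ρ t) (u t) (θ t) ζρ ζe ζm - macroPairing (ρ 0) (u 0) (θ 0) ζρ ζe ζm =
      kineticFluxIntegral ρ u θ t ζρ ζe ζm + excessFluxIntegral σ ρ u θ t ζe ζm

/-- The statement of `stub_initialMeanConvergence` (M, provable now), keyed by the registered stub name (hypothesis of
`ForwardMeanHydro_of`; body VERBATIM the stub's). -/
abbrev stub_initialMeanConvergence : Prop :=
  ∀ σ : ℝ, 0 < σ → σ ≤ 1 / 2 → ∀ (a₀ θ₀ : T3 → ℝ) (u₀ : T3 → V3), Continuous a₀ → Continuous θ₀ → Continuous u₀ →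
    (∀ x, 0 < a₀ x) → (∀ x, 0 < θ₀ x) →
    ∀ Φ : (N : ℕ) → HardSphereFlow (Torus.geometry (Fin 3)) (hsDiameter σ N) (N + 1),
    (∀ N, IsProbabilityMeasure (localGibbsLaw σ a₀ u₀ θ₀ N (Φ N))) →
    ∀ (ρ θ : ℝ → T3 → ℝ) (u : ℝ → T3 → V3), Continuous (ρ 0) → Continuous (θ 0) → Continuous (u 0) →
    TendstoHydroFieldsAt (fun N => localGibbsLaw σ a₀ u₀ θ₀ N (Φ N)) Φ ρ u θ 0 →
    ∀ (ζρ ζe : T3 → ℝ) (ζm : T3 → V3), Continuous ζρ → Continuous ζe → Continuous ζm →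
    Tendsto (fun N : ℕ => meanTilt σ a₀ u₀ θ₀ N (Φ N) 0 ζρ ζe ζm) atTop
      (𝓝 (macroPairing (ρ 0) (u 0) (θ 0) ζρ ζe ζm))

/-- The statement of `stub_continuousTiltExtension` (M, provable now), keyed by the registered stub name (hypothesis of
`ForwardMeanHydro_of`; body VERBATIM the stub's). -/
abbrev stub_continuousTiltExtension : Prop :=
  ∀ σ : ℝ, 0 < σ → σ ≤ 1 / 2 → ∀ (a₀ θ₀ : T3 → ℝ) (u₀ : T3 → V3), Continuous a₀ → Continuous θ₀ → Continuous u₀ →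
    (∀ x, 0 < a₀ x) → (∀ x, 0 < θ₀ x) →
    ∀ Φ : (N : ℕ) → HardSphereFlow (Torus.geometry (Fin 3)) (hsDiameter σ N) (N + 1),
    (∀ N, IsProbabilityMeasure (localGibbsLaw σ a₀ u₀ θ₀ N (Φ N))) →
    ∀ (t : ℝ) (R Θ : T3 → ℝ) (U : T3 → V3), Continuous R → Continuous Θ → Continuous U →
    (∀ (ζρ ζe : T3 → ℝ) (ζm : T3 → V3), Torus.IsSmooth ζρ → Torus.IsSmooth ζe → Torus.IsSmooth ζm →
      Tendsto (fun N : ℕ => meanTilt σ a₀ u₀ θ₀ N (Φ N) t ζρ ζe ζm) atTop (𝓝 (macroPairing R U Θ ζρ ζe ζm))) →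
    ∀ (lρ le : T3 → ℝ) (lm : T3 → V3), Continuous lρ → Continuous le → Continuous lm →
    Tendsto (fun N : ℕ => ∫ z, (∫ y, (lρ y.1 + ⟪lm y.1, y.2⟫_ℝ + le y.1 * (‖y.2‖ ^ 2 / 2))
        ∂(empiricalMeasure ((Φ N).flow t z))) ∂(localGibbsLaw σ a₀ u₀ θ₀ N (Φ N))) atTop
      (𝓝 (∫ x, (lρ x * R x + R x * ⟪lm x, U x⟫_ℝ + le x * totalEnergyDensity (R x) (U x) (Θ x))))

end __Registered

/-! ## §3 The registered stubs (`sorry` lives ONLY here; bodies VERBATIM the `__Registered` aliases) -/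

/-- **STUB `stub_kineticFluxClosure` — MEAN KINETIC (STREAMING) FLUX CLOSURE onto the local-Maxwellian moments of the
classical solution (OPEN; the HARDEST stub, the crux's one-body content).** Under the crux prefix (verbatim: `∃ η₀`
outermost, continuous positive profiles, `∃ σ₀`, `σ < σ₀`, classical hs-Euler solution on `[0,T)` with packing guard,
flows, local Gibbs laws probability measures, fields converging at `t = 0`), for every `t ∈ [0,T)` and every SMOOTH
time-independent tilt: `E_{f₀}[∫_{[0,t]} streamingRate ζ (Φ_N(s) z) ds] → kineticFluxIntegral ρ u θ t ζ`, i.e. the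
time-integrated mean free-transport fluxes of mass, momentum and kinetic energy (velocity moments of orders 1, 2, 3 of
the one-particle marginal, paired with `∇ζ`) converge to `∫₀ᵗ∫ (ρu·∇ζ_ρ + (ρu⊗u + ρθ𝟙):∇ζ_m + (E + ρθ)u·∇ζ_e)`.
Why plausibly true: it is local equilibrium IN THE MEAN along the Euler solution — under a local Gibbs law velocities
are exactly conditionally Maxwellian, so the statement holds at `s = 0` and is what every closure engine of the board
outputs first (one-particle-marginal level, no fluctuation / block / two-marginal content). Why it might fail: an
Euler-order anomaly of the mean kinetic stress or mean heat flux of deterministic spheres at fixed `σ` before the shock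
(no mixing theorem at fixed density, Spohn1991 I.3); free flight fails it (phase mixing) — any proof must use
collisions. Size: open-problem (XL). Leans on: `localGibbsLaw`, `HardSphereFlow.flow`, `empiricalMeasure`,
`Torus.gradient/partialDeriv` (Literature); Spohn1991 I §3.3, OllaVaradhanYau1993 §1, KipnisLandim1999 Ch. 6,
Literature.Barriers.AtomisticToContinuum.BoltzmannHypothesisBarrierNarrow. -/
theorem stub_kineticFluxClosure :
    ∃ η₀ : ℝ, 0 < η₀ ∧ ∀ (a₀ θ₀ : T3 → ℝ) (u₀ : T3 → V3), Continuous a₀ → Continuous θ₀ → Continuous u₀ →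
    (∀ x, 0 < a₀ x) → (∀ x, 0 < θ₀ x) → ∃ σ₀ : ℝ, 0 < σ₀ ∧ ∀ σ : ℝ, 0 < σ → σ < σ₀ →
    ∀ (T : ℝ) (ρ θ : ℝ → T3 → ℝ) (u : ℝ → T3 → V3), IsHardSphereEulerSolution σ T ρ u θ →
    (∀ t ∈ Set.Ico 0 T, ∀ x, ρ t x * σ ^ 3 < η₀) →
    ∀ Φ : (N : ℕ) → HardSphereFlow (Torus.geometry (Fin 3)) (hsDiameter σ N) (N + 1),
    (∀ N, IsProbabilityMeasure (localGibbsLaw σ a₀ u₀ θ₀ N (Φ N))) →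
    TendstoHydroFieldsAt (fun N => localGibbsLaw σ a₀ u₀ θ₀ N (Φ N)) Φ ρ u θ 0 →
    ∀ t ∈ Set.Ico 0 T, ∀ (ζρ ζe : T3 → ℝ) (ζm : T3 → V3),
    Torus.IsSmooth ζρ → Torus.IsSmooth ζe → Torus.IsSmooth ζm →
    Tendsto (fun N : ℕ => meanStreamingFlux σ a₀ u₀ θ₀ N (Φ N) t ζρ ζe ζm) atTop
      (𝓝 (kineticFluxIntegral ρ u θ t ζρ ζe ζm)) := by
  sorry

/-- **STUB `stub_collisionalTransferClosure` — MEAN COLLISIONAL-TRANSFER CLOSURE onto the excess (virial) pressure of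
the classical solution (OPEN, XL; the crux's two-body content).** Same prefix; conclusion
`E_{f₀}[collisionalTransfer σ (Φ N) t ζ_e ζ_m] → excessFluxIntegral σ ρ u θ t ζ_e ζ_m = ∫₀ᵗ∫ (p_hs − ρθ)(div ζ_m +
u·∇ζ_e)`: the mean momentum and energy transferred at contacts in `(0,t]` — `O(1)` at fixed reduced density — is, to
leading order, the isotropic excess pressure `ρθ(Z(ρσ³) − 1)` doing work at velocity `u` (zero mean collisional heat
flux). Why plausibly true: for a local Gibbs law the contact value of the pair correlation is the equilibrium one at the
local density, and the virial theorem `Z − 1 = (2π/3) η g(σ⁺) = η f_ex′(η)` (`hsCompressibility`) converts the mean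
impulse flux across the contact shell into `p_hs − ρθ`; the impulse arm `x_i − x_j = εω` turns `ζ_m(x_i) − ζ_m(x_j)`
into `ε(ω·∇)ζ_m` for smooth tilts. Why it might fail: needs the two-body contact statistics IN THE MEAN to stay at
their local-equilibrium value along the evolution (Enskog-type contact chaos in the mean) — a dynamical input of the
Boltzmann-hypothesis class; dense pockets beyond the guard are excluded only in the mean. Size: open-problem (XL).
Leans on: `collisionTimes`, `reflectVel`, `Geometry.sepVec`, `hsPressure`, `hsCompressibility` (Literature);
`Theorems.ImplosionDichotomyHsEosLowDensity` (EOS in the band); CIPDiluteGases1994 §4, Resibois1978, Spohn1991 I §3.3,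
Literature.Barriers.AtomisticToContinuum.BoltzmannHypothesisBarrierNarrow. -/
theorem stub_collisionalTransferClosure :
    ∃ η₀ : ℝ, 0 < η₀ ∧ ∀ (a₀ θ₀ : T3 → ℝ) (u₀ : T3 → V3), Continuous a₀ → Continuous θ₀ → Continuous u₀ →
    (∀ x, 0 < a₀ x) → (∀ x, 0 < θ₀ x) → ∃ σ₀ : ℝ, 0 < σ₀ ∧ ∀ σ : ℝ, 0 < σ → σ < σ₀ →
    ∀ (T : ℝ) (ρ θ : ℝ → T3 → ℝ) (u : ℝ → T3 → V3), IsHardSphereEulerSolution σ T ρ u θ →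
    (∀ t ∈ Set.Ico 0 T, ∀ x, ρ t x * σ ^ 3 < η₀) →
    ∀ Φ : (N : ℕ) → HardSphereFlow (Torus.geometry (Fin 3)) (hsDiameter σ N) (N + 1),
    (∀ N, IsProbabilityMeasure (localGibbsLaw σ a₀ u₀ θ₀ N (Φ N))) →
    TendstoHydroFieldsAt (fun N => localGibbsLaw σ a₀ u₀ θ₀ N (Φ N)) Φ ρ u θ 0 →
    ∀ t ∈ Set.Ico 0 T, ∀ (ζρ ζe : T3 → ℝ) (ζm : T3 → V3),
    Torus.IsSmooth ζρ → Torus.IsSmooth ζe → Torus.IsSmooth ζm →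
    Tendsto (fun N : ℕ => meanCollisionalTransfer σ a₀ u₀ θ₀ N (Φ N) t ζe ζm) atTop
      (𝓝 (excessFluxIntegral σ ρ u θ t ζe ζm)) := by
  sorry

/-- **STUB `stub_meanBalanceLaw` — EXACT FINITE-`N` MEAN BALANCE LAW (Bogolyubov's weak equation in the mean; M–L,
provable now).** For `0 < σ < 1/2`, continuous positive profiles, every `N`, every flow `Φ` of `N+1` spheres, `t ≥ 0`
and smooth tilts: `meanTilt t − meanTilt 0 = meanStreamingFlux t + meanCollisionalTransfer t`. Pathwise, on every good
orbit, `⟨ζ,F(Φ_t z)⟩ − ⟨ζ,F(Φ_0 z)⟩ = ∫₀ᵗ streamingRate ζ (Φ_s z) ds + collisionalTransfer` is the un-mollified twin of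
the LANDED `Theorems.ChaosClosesEulerWeakEquation.stub_weakEquation` (free flight between the locally finite collision
times: `glue_pieces`, `ftc_free_left`; ordered contact pairs ↔ particle jumps: `pairSum_eq_particleSum`; or let `r → 0`
in the landed mollified identity at fixed `N`); integrate against `f₀ = localGibbsLaw …` (a.e. orbit is good: `f₀ ≪`
Liouville, `HardSphereFlow.ae_mem_good`) and split the expectation — the streaming term is `f₀`-integrable (cubic
velocity moments, Gaussian given positions; `(s, z) ↦ Φ_s z` jointly measurable by right-continuity of good orbits),
hence so is the collision term. Why it might fail: only through a measurability/integrability slip (the identity is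
deterministic); `σ < 1/2` keeps `Torus.isHardSphereRegular_geometry`. Size: M–L. Leans on:
`Theorems.ChaosClosesEulerWeakEquation.glue_pieces/ftc_free_left`, `HardSphereFlow.isTrajectory`,
`integral_empiricalMeasure`, `QuenchedCellClock.integrable_sum_norm_sq_localGibbsLaw`; Bogolyubov1975,
PulvirentiSimonella arXiv:1504.03215 §1. -/
theorem stub_meanBalanceLaw :
    ∀ σ : ℝ, 0 < σ → σ < 1 / 2 → ∀ (a₀ θ₀ : T3 → ℝ) (u₀ : T3 → V3), Continuous a₀ → Continuous θ₀ → Continuous u₀ →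
    (∀ x, 0 < a₀ x) → (∀ x, 0 < θ₀ x) →
    ∀ (N : ℕ) (Φ : HardSphereFlow (Torus.geometry (Fin 3)) (hsDiameter σ N) (N + 1)),
    ∀ t : ℝ, 0 ≤ t → ∀ (ζρ ζe : T3 → ℝ) (ζm : T3 → V3),
    Torus.IsSmooth ζρ → Torus.IsSmooth ζe → Torus.IsSmooth ζm →
    meanTilt σ a₀ u₀ θ₀ N Φ t ζρ ζe ζm - meanTilt σ a₀ u₀ θ₀ N Φ 0 ζρ ζe ζm =
      meanStreamingFlux σ a₀ u₀ θ₀ N Φ t ζρ ζe ζm + meanCollisionalTransfer σ a₀ u₀ θ₀ N Φ t ζe ζm := by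
  sorry

/-- **STUB `stub_eulerWeakForm` — EXACT WEAK EULER IDENTITY FOR THE CLASSICAL SOLUTION, fluxes split as kinetic +
excess (M, provable now).** There is an EOS-regularity threshold `η₁ > 0` (prover-chosen, outermost) such that for
`σ > 0`, every classical hs-Euler solution on `[0,T)` with `ρ_t(x)σ³ < η₁`, every `t ∈ [0,T)` and smooth tilts:
`⟨ζ,P_t⟩ − ⟨ζ,P_0⟩ = kineticFluxIntegral ρ u θ t ζ + excessFluxIntegral σ ρ u θ t ζ_e ζ_m` (the two integrals sum to
`∫₀ᵗ∫ (ρu·∇ζ_ρ + Σ_{jk}(ρu_ju_k + pδ_{jk})∂_jζ_{m,k} + (E + p)u·∇ζ_e)`, `p = hsPressure σ ρ θ`). Proof sketch: below `η₁`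
the excess free energy is smooth (`Theorems.ImplosionDichotomyHsEosLowDensity` / `HsEosLowDensity_holds`:
`EqOn hsExcessFreeEnergy F (Ico 0 η₀)` with `F` analytic), so `x ↦ hsPressure σ (ρ_s x) (θ_s x)` and `(E + p)u` are
`Torus.IsSmooth` and the `Torus.gradient`/`Torus.divergence` in `IsHardSphereEulerSolution.momentum/energy` are genuine
derivatives; pair the three equations with `ζ_ρ, ζ_m, ζ_e`, integrate by parts on `𝕋³`
(`Torus.integral_inner_gradient_eq_neg_integral_mul_divergence`, `integral_partialDeriv_eq_zero`, proved in
`TorusCalculusProofs`), identify `timeDerivWithin (Ico 0 T)` with the derivative of the smooth slice pairing and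
integrate over `[0,t]` (FTC; all integrands continuous on the compact `[0,t] × 𝕋³`). Why it might fail: only if the
guard did not buy EOS smoothness (it does, in the band) — without the guard the structure's junk derivatives would
make it false. Size: M. Leans on: `IsHardSphereEulerSolution`, `Torus.*` calculus + IBP facts, `HsEosLowDensity`;
Spohn1991 I (3.21), Evans2010 App. C.2. -/
theorem stub_eulerWeakForm :
    ∃ η₁ : ℝ, 0 < η₁ ∧ ∀ σ : ℝ, 0 < σ →
    ∀ (T : ℝ) (ρ θ : ℝ → T3 → ℝ) (u : ℝ → T3 → V3), IsHardSphereEulerSolution σ T ρ u θ →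
    (∀ t ∈ Set.Ico 0 T, ∀ x, ρ t x * σ ^ 3 < η₁) →
    ∀ t ∈ Set.Ico 0 T, ∀ (ζρ ζe : T3 → ℝ) (ζm : T3 → V3),
    Torus.IsSmooth ζρ → Torus.IsSmooth ζe → Torus.IsSmooth ζm →
    macroPairing (ρ t) (u t) (θ t) ζρ ζe ζm - macroPairing (ρ 0) (u 0) (θ 0) ζρ ζe ζm =
      kineticFluxIntegral ρ u θ t ζρ ζe ζm + excessFluxIntegral σ ρ u θ t ζe ζm := by
  sorry

/-- **STUB `stub_initialMeanConvergence` — CONVERGENCE IN PROBABILITY AT `t = 0` UPGRADES TO CONVERGENCE IN MEAN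
(M, provable now).** For `0 < σ ≤ 1/2`, continuous positive profiles, flows, local Gibbs laws that are probability
measures, fields `(ρ, u, θ)` with CONTINUOUS `t = 0` slices and `TendstoHydroFieldsAt f₀ Φ ρ u θ 0`, every continuous
tilt statistic converges in the mean at time `0`: `meanTilt 0 ζ → ⟨ζ, P_0⟩`. Proof sketch: `tiltStatistic_eq_fields`
writes the statistic as density(ζ_ρ) + Σᵢ momentum(ζ_{m,i})ᵢ + energy(ζ_e); each converges in probability to its
target by hypothesis; the family is uniformly integrable — `E_{f₀}[((N+1)⁻¹Σ(1 + |vᵢ|²))²] ≤ C` uniformly in `N`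
because under `localGibbsLaw` velocities are independent Gaussians `N(u₀(xᵢ), θ₀(xᵢ)𝟙)` given positions and the
profiles are bounded on the compact torus (Cauchy–Schwarz on the tail event); continuity of `(ρ 0, u 0, θ 0)` makes
the three target integrals finite and additive (`integrable_of_continuous_T3`). Why it might fail: only through the
`Φ_0` convention (`TendstoHydroFieldsAt … 0` and `meanTilt … 0` both read `Φ.flow 0 z`, = `z` a.e.). Size: M. Leans on:
`tiltStatistic_eq_fields`, `measurable_tiltStatistic`, `QuenchedCellClock.integrable_sum_norm_sq_localGibbsLaw`,
`abs_oneBody_le`; OllaVaradhanYau1993 §1. -/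
theorem stub_initialMeanConvergence :
    ∀ σ : ℝ, 0 < σ → σ ≤ 1 / 2 → ∀ (a₀ θ₀ : T3 → ℝ) (u₀ : T3 → V3), Continuous a₀ → Continuous θ₀ → Continuous u₀ →
    (∀ x, 0 < a₀ x) → (∀ x, 0 < θ₀ x) →
    ∀ Φ : (N : ℕ) → HardSphereFlow (Torus.geometry (Fin 3)) (hsDiameter σ N) (N + 1),
    (∀ N, IsProbabilityMeasure (localGibbsLaw σ a₀ u₀ θ₀ N (Φ N))) →
    ∀ (ρ θ : ℝ → T3 → ℝ) (u : ℝ → T3 → V3), Continuous (ρ 0) → Continuous (θ 0) → Continuous (u 0) →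
    TendstoHydroFieldsAt (fun N => localGibbsLaw σ a₀ u₀ θ₀ N (Φ N)) Φ ρ u θ 0 →
    ∀ (ζρ ζe : T3 → ℝ) (ζm : T3 → V3), Continuous ζρ → Continuous ζe → Continuous ζm →
    Tendsto (fun N : ℕ => meanTilt σ a₀ u₀ θ₀ N (Φ N) 0 ζρ ζe ζm) atTop
      (𝓝 (macroPairing (ρ 0) (u 0) (θ 0) ζρ ζe ζm)) := by
  sorry

/-- **STUB `stub_continuousTiltExtension` — SMOOTH TILTS SUFFICE AT TIME `t` (uniform integrability + density; M,
provable now).** For `0 < σ ≤ 1/2`, continuous positive profiles, flows, local Gibbs laws that are probability measures,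
any `t`, and continuous target fields `(R, U, Θ)`: if `meanTilt t ζ → ⟨ζ,(R,U,Θ)⟩` for all SMOOTH tilts then the
crux's conclusion (inline form, verbatim) holds for all CONTINUOUS tilts. Proof sketch: `ε/3` — smooth functions are
dense in `C(𝕋³; ℝ)` and `C(𝕋³; ℝ³)` for the sup norm (Fourier monomials on `UnitAddTorus (Fin 3)` / Stone–Weierstrass
with `Torus.IsSmooth` separating functions); the microscopic error is `≤ ‖ζ − ζ′‖_∞ · E_{f₀}[(N+1)⁻¹Σᵢ(1 + |vᵢ(t)| +
|vᵢ(t)|²/2)]`, bounded uniformly in `N` since kinetic energy is conserved on good orbits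
(`HardSphereFlow.configEnergy_flow`, a.e. orbit good under `f₀ ≪` Liouville) and has bounded mean under the local Gibbs
law; the macroscopic error is `≤ ‖ζ − ζ′‖_∞ ∫ (|R| + |R||U| + |E(R,U,Θ)|)`. Why it might fail: no — classical; the only
trap is linearity of `meanTilt` in the tilt, which needs the integrability just described. Size: M. Leans on:
`measurable_tiltStatistic`, `tiltStatistic_add`, `HardSphereFlow.configEnergy_flow`,
`QuenchedCellClock.integrable_sum_norm_sq_localGibbsLaw`, Mathlib `span_fourier_closure_eq_top`-type density. -/
theorem stub_continuousTiltExtension :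
    ∀ σ : ℝ, 0 < σ → σ ≤ 1 / 2 → ∀ (a₀ θ₀ : T3 → ℝ) (u₀ : T3 → V3), Continuous a₀ → Continuous θ₀ → Continuous u₀ →
    (∀ x, 0 < a₀ x) → (∀ x, 0 < θ₀ x) →
    ∀ Φ : (N : ℕ) → HardSphereFlow (Torus.geometry (Fin 3)) (hsDiameter σ N) (N + 1),
    (∀ N, IsProbabilityMeasure (localGibbsLaw σ a₀ u₀ θ₀ N (Φ N))) →
    ∀ (t : ℝ) (R Θ : T3 → ℝ) (U : T3 → V3), Continuous R → Continuous Θ → Continuous U →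
    (∀ (ζρ ζe : T3 → ℝ) (ζm : T3 → V3), Torus.IsSmooth ζρ → Torus.IsSmooth ζe → Torus.IsSmooth ζm →
      Tendsto (fun N : ℕ => meanTilt σ a₀ u₀ θ₀ N (Φ N) t ζρ ζe ζm) atTop (𝓝 (macroPairing R U Θ ζρ ζe ζm))) →
    ∀ (lρ le : T3 → ℝ) (lm : T3 → V3), Continuous lρ → Continuous le → Continuous lm →
    Tendsto (fun N : ℕ => ∫ z, (∫ y, (lρ y.1 + ⟪lm y.1, y.2⟫_ℝ + le y.1 * (‖y.2‖ ^ 2 / 2))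
        ∂(empiricalMeasure ((Φ N).flow t z))) ∂(localGibbsLaw σ a₀ u₀ θ₀ N (Φ N))) atTop
      (𝓝 (∫ x, (lρ x * R x + R x * ⟪lm x, U x⟫_ℝ + le x * totalEnergyDensity (R x) (U x) (Θ x)))) := by
  sorry

/-- The registered theorems and their `__Registered` aliases are the same statements (definitional check). -/
example : __Registered.stub_kineticFluxClosure := stub_kineticFluxClosure
example : __Registered.stub_collisionalTransferClosure := stub_collisionalTransferClosure
example : __Registered.stub_meanBalanceLaw := stub_meanBalanceLaw
example : __Registered.stub_eulerWeakForm := stub_eulerWeakForm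
example : __Registered.stub_initialMeanConvergence := stub_initialMeanConvergence
example : __Registered.stub_continuousTiltExtension := stub_continuousTiltExtension

/-! ## §4 The assembly (real proof, no `sorry`) -/

/-- **THE SKELETON THEOREM — the six registered stubs (by name, via their `__Registered` aliases: kinetic closure,
collisional closure, balance law, weak Euler form, initial mean convergence, continuous-tilt extension) imply the crux
`ForwardMeanHydro` BY NAME.** Real proof, no `sorry`: thresholds `η₀ := min η_K (min η_C η₁)`, `σ₀ := min σ_K (min σ_C (1/2))`; the Euler
slices at `0` and `t` are continuous (`IsSmoothSpaceTimeOn.isSmooth_slice`); `stub_continuousTiltExtension` reduces the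
crux's continuous tilt to smooth tilts; for a smooth tilt the balance law holds at every `N`, the three limits add
(`Tendsto.add`), and the weak Euler identity identifies the limit (`linarith` under `Tendsto.congr`). -/
theorem ForwardMeanHydro_of :
    __Registered.stub_kineticFluxClosure →
    __Registered.stub_collisionalTransferClosure →
    __Registered.stub_meanBalanceLaw →
    __Registered.stub_eulerWeakForm →
    __Registered.stub_initialMeanConvergence →
    __Registered.stub_continuousTiltExtension →
    ForwardMeanHydro := by
  intro hK hC hB hW hI hX
  obtain ⟨η₁, hη₁, HK⟩ := hK
  obtain ⟨η₂, hη₂, HC⟩ := hC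
  obtain ⟨η₃, hη₃, HW⟩ := hW
  refine ⟨min η₁ (min η₂ η₃), lt_min hη₁ (lt_min hη₂ hη₃), fun a₀ θ₀ u₀ ha hθ hu hap hθp => ?_⟩
  obtain ⟨σ₁, hσ₁, GK⟩ := HK a₀ θ₀ u₀ ha hθ hu hap hθp
  obtain ⟨σ₂, hσ₂, GC⟩ := HC a₀ θ₀ u₀ ha hθ hu hap hθp
  refine ⟨min σ₁ (min σ₂ (1 / 2)), lt_min hσ₁ (lt_min hσ₂ one_half_pos), ?_⟩
  intro σ hσ hσl T ρ θ u hE hg Φ hP h0 t ht lρ le lm hlρ hle hlm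
  obtain ⟨hσ₁', hσl'⟩ := lt_min_iff.mp hσl
  obtain ⟨hσ₂', hσh⟩ := lt_min_iff.mp hσl'
  have hσ2 : σ ≤ 1 / 2 := hσh.le
  -- the three packing guards
  have hg₁ : ∀ s ∈ Set.Ico 0 T, ∀ x, ρ s x * σ ^ 3 < η₁ := fun s hs x =>
    (hg s hs x).trans_le (min_le_left _ _)
  have hg₂ : ∀ s ∈ Set.Ico 0 T, ∀ x, ρ s x * σ ^ 3 < η₂ := fun s hs x =>
    (hg s hs x).trans_le ((min_le_right _ _).trans (min_le_left _ _))
  have hg₃ : ∀ s ∈ Set.Ico 0 T, ∀ x, ρ s x * σ ^ 3 < η₃ := fun s hs x =>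
    (hg s hs x).trans_le ((min_le_right _ _).trans (min_le_right _ _))
  -- continuity of the Euler slices at `0` and `t`
  have h0T : (0 : ℝ) ∈ Set.Ico 0 T := ⟨le_rfl, ht.1.trans_lt ht.2⟩
  have hρt : Continuous (ρ t) := (hE.smooth_density.isSmooth_slice ht).continuous
  have hθt : Continuous (θ t) := (hE.smooth_temperature.isSmooth_slice ht).continuous
  have hut : Continuous (u t) := (hE.smooth_velocity.isSmooth_slice ht).continuous
  have hρz : Continuous (ρ 0) := (hE.smooth_density.isSmooth_slice h0T).continuous
  have hθz : Continuous (θ 0) := (hE.smooth_temperature.isSmooth_slice h0T).continuous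
  have huz : Continuous (u 0) := (hE.smooth_velocity.isSmooth_slice h0T).continuous
  -- reduce the crux's continuous tilt to smooth tilts (uniform integrability + density)
  refine hX σ hσ hσ2 a₀ θ₀ u₀ ha hθ hu hap hθp Φ hP t (ρ t) (θ t) (u t) hρt hθt hut ?_ lρ le lm hlρ hle hlm
  intro ζρ ζe ζm hζρ hζe hζm
  -- exact finite-N mean balance law at every N
  have eB : ∀ N : ℕ, meanTilt σ a₀ u₀ θ₀ N (Φ N) t ζρ ζe ζm - meanTilt σ a₀ u₀ θ₀ N (Φ N) 0 ζρ ζe ζm =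
      meanStreamingFlux σ a₀ u₀ θ₀ N (Φ N) t ζρ ζe ζm + meanCollisionalTransfer σ a₀ u₀ θ₀ N (Φ N) t ζe ζm :=
    fun N => hB σ hσ hσh a₀ θ₀ u₀ ha hθ hu hap hθp N (Φ N) t ht.1 ζρ ζe ζm hζρ hζe hζm
  -- the three limits: initial tie in the mean, kinetic closure, collisional closure
  have lI := hI σ hσ hσ2 a₀ θ₀ u₀ ha hθ hu hap hθp Φ hP ρ θ u hρz hθz huz h0 ζρ ζe ζm
    hζρ.continuous hζe.continuous hζm.continuous
  have lK := GK σ hσ hσ₁' T ρ θ u hE hg₁ Φ hP h0 t ht ζρ ζe ζm hζρ hζe hζm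
  have lC := GC σ hσ hσ₂' T ρ θ u hE hg₂ Φ hP h0 t ht ζρ ζe ζm hζρ hζe hζm
  -- the exact weak Euler identity for the classical solution
  have eW := HW σ hσ T ρ θ u hE hg₃ t ht ζρ ζe ζm hζρ hζe hζm
  have key := (lI.add lK).add lC
  rw [show macroPairing (ρ t) (u t) (θ t) ζρ ζe ζm =
      macroPairing (ρ 0) (u 0) (θ 0) ζρ ζe ζm + kineticFluxIntegral ρ u θ t ζρ ζe ζm +
        excessFluxIntegral σ ρ u θ t ζe ζm by linarith [eW]]
  exact key.congr fun N => by linarith [eB N]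

/-- The six registered stubs fill the six hypotheses (wiring check: the registered signatures ARE, definitionally, the
hypotheses of `ForwardMeanHydro_of`; an `example`, so the skeleton theorem stays the unique local theorem concluding the
crux; it depends on the stubs' `sorry`, declares none). -/
example : ForwardMeanHydro :=
  ForwardMeanHydro_of stub_kineticFluxClosure stub_collisionalTransferClosure stub_meanBalanceLaw
    stub_eulerWeakForm stub_initialMeanConvergence stub_continuousTiltExtension

end Summit.AtomisticToContinuum.HydrodynamicLimit.Cruxes.ForwardMeanHydro.Birth

end
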